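import Summits.HubbardSuperconductivity.HubbardLadder.PairCorrStaggeredSumRule
import HarnessLib

/-!
# Rung R3 tooling — the staggered sum rule of the `d`-wave pair correlator, EXPLICIT SIXTEEN-TERM FORM on the
# `4 × 4` torus (P60 (g)(i), per state): `Σ_{a,b=0}^{3} (−1)^{a+b} P̄_d(4, (a,b); ψ) = 0` for EVERY state `ψ`

HONEST FRAMING (page 1): ladder R1–R4 with certified numbers; no claim on H/H₀.

HONEST LABEL: an EXACT IDENTITY — PROVED, no certificate, no number, nothing run (2026-08-21). This is §5 of
`PairCorrStaggeredSumRule.lean` (LEAN FILING REQUEST #193), moved to its own file ONLY for the 400-line file-size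
lint (LEAD LINE (PP) 2026-08-21T09:22:46Z (2)); every declaration is byte-identical to the registered bytes
(`PairCorrStaggeredSumRule.lean` sha256 e3fbe6a8…61b1, 454 l., §5). It specialises the general even-torus row
identity `sum_stagger_re_mul_pairCorrSum_re_eq_zero` (§3 there) to `L = 4` and expands the torus sum over the R3
displacement vocabulary `Torus.proj 4 ![a, b]`: for EVERY state `ψ` of the `4 × 4` fermionic torus (any filling,
any `S^z`, no symmetry assumed) the signed sum of the sixteen rows `P̄_d(4, (a,b); ψ)` (`avgPairCorr 4 ![a, b] ψ`,
R3R4Props), sign `(−1)^{a+b}`, vanishes; for a `D₄`-invariant functional this is the printed bug check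
`V00 − 4·V10 + 4·V11 + 2·V20 − 4·V21 + V22 = 0` of `pub-hubbard-pseudo` §13 P60 (g)(i) (LEAD LINE (KK)
2026-08-21T07:46:34Z). Result line (iii) of record is unchanged: no R3 instance has been run; no dichotomy is
certified at any size; there are no brackets to overlap.

Contents: `stagger_re_of_parity_eq_zero` / `_ne_zero`, `torusProj_vec2`, `sum_univ_torusSite_four` (a sum over the
sixteen sites expanded over `Torus.proj 4 ![a, b]`), `avgPairCorr_four` (`P̄_d(4, r; ψ)` unfolded),
`avgPairCorr_four_staggered_sum_eq_zero` (the sixteen-term identity).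

References: Scalapino, Phys. Rep. 250 (1995) 329, §2 eq. (2.4); Qin et al., PRX 10 (2020) 031016, §II eqs. (2)–(4)
(`P̄_d`); Dyson–Lieb–Simon, J. Stat. Phys. 18 (1978) 335, §2 (bipartite even torus). The identity is folklore.
-/

noncomputable section

namespace Summit.HubbardSuperconductivity.HubbardLadder

open Matrix Literature.MathematicalPhysics.QuantumLattice Literature.Probability.LatticeModels
open Finset hiding expect
open scoped ComplexOrder

/-! ## §5 The explicit sixteen-term identity on the `4 × 4` torus (P60 (g)(i), per state) -/

section Four

/-- `2 ∣ 4`. -/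
private theorem two_dvd_four : 2 ∣ 4 := ⟨2, rfl⟩

/-- `Re ε(x) = 1` on the even sublattice. [folklore] -/
theorem stagger_re_of_parity_eq_zero {L : ℕ} (hL : 2 ∣ L) {x : TorusSite 2 L}
    (h : torusSiteParity hL x = 0) : (stagger hL x).re = 1 := by
  rw [stagger_re, if_pos h]

/-- `Re ε(x) = −1` on the odd sublattice. [folklore] -/
theorem stagger_re_of_parity_ne_zero {L : ℕ} (hL : 2 ∣ L) {x : TorusSite 2 L}
    (h : torusSiteParity hL x ≠ 0) : (stagger hL x).re = -1 := by
  rw [stagger_re, if_neg h]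

/-- `Torus.proj` of an explicit integer pair. [folklore] -/
theorem torusProj_vec2 (L : ℕ) (a b : ℤ) :
    Torus.proj (d := 2) L ![a, b] = ![(a : ZMod L), (b : ZMod L)] := by
  funext i
  fin_cases i <;> rfl

/-- A sum over `ℤ/4ℤ`, expanded over the residues written as integer casts. [folklore] -/
private theorem sum_univ_zmod_four {M : Type*} [AddCommMonoid M] (g : ZMod 4 → M) :
    ∑ a : ZMod 4, g a =
      g ((0 : ℤ) : ZMod 4) + g ((1 : ℤ) : ZMod 4) + g ((2 : ℤ) : ZMod 4) + g ((3 : ℤ) : ZMod 4) := by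
  have h := (Fintype.sum_equiv (ZMod.finEquiv 4).toEquiv (fun i => g (ZMod.finEquiv 4 i)) g
    fun _ => rfl).symm
  have e0 : ZMod.finEquiv 4 0 = ((0 : ℤ) : ZMod 4) := by decide
  have e1 : ZMod.finEquiv 4 1 = ((1 : ℤ) : ZMod 4) := by decide
  have e2 : ZMod.finEquiv 4 2 = ((2 : ℤ) : ZMod 4) := by decide
  have e3 : ZMod.finEquiv 4 3 = ((3 : ℤ) : ZMod 4) := by decide
  rw [h, Fin.sum_univ_four, e0, e1, e2, e3]

/-- A sum over the sixteen sites of the `4 × 4` torus, expanded over the projections of the integer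
vectors `(a, b)`, `0 ≤ a, b < 4` (the R3 displacement vocabulary `Torus.proj 4 ![a, b]`). [folklore] -/
theorem sum_univ_torusSite_four {M : Type*} [AddCommMonoid M] (f : TorusSite 2 4 → M) :
    ∑ s : TorusSite 2 4, f s =
      f (Torus.proj 4 ![0, 0]) + f (Torus.proj 4 ![0, 1]) + f (Torus.proj 4 ![0, 2]) +
          f (Torus.proj 4 ![0, 3]) +
        (f (Torus.proj 4 ![1, 0]) + f (Torus.proj 4 ![1, 1]) + f (Torus.proj 4 ![1, 2]) +
          f (Torus.proj 4 ![1, 3])) +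
        (f (Torus.proj 4 ![2, 0]) + f (Torus.proj 4 ![2, 1]) + f (Torus.proj 4 ![2, 2]) +
          f (Torus.proj 4 ![2, 3])) +
        (f (Torus.proj 4 ![3, 0]) + f (Torus.proj 4 ![3, 1]) + f (Torus.proj 4 ![3, 2]) +
          f (Torus.proj 4 ![3, 3])) := by
  rw [Fintype.sum_equiv (piFinTwoEquiv fun _ => ZMod 4) f (fun ab => f ![ab.1, ab.2]) (fun s => by
      show f s = f ![s 0, s 1]
      congr 1
      funext i
      fin_cases i <;> rfl),
    Fintype.sum_prod_type]
  simp only [sum_univ_zmod_four, torusProj_vec2]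

/-- `P̄_d(4, r; ψ)` unfolded: `(Σ_x Re⟨ψ, Δ_x† Δ_{x + r̄} ψ⟩) / 16`. [cite: QinEtAl2020, §II eq. (4)] -/
theorem avgPairCorr_four (r : Site 2) (ψ : Fock (Orb (FermionTorus 2 4))) :
    avgPairCorr 4 r ψ =
      (∑ x : TorusSite 2 4, (expect ((localPair dWaveFormFactor 4 x)ᴴ *
        localPair dWaveFormFactor 4 (x + Torus.proj 4 r)) ψ).re) / 16 := by
  rw [show (16 : ℝ) = ((3 + 1 : ℕ) : ℝ) ^ 2 by norm_num]
  exact avgPairCorr_succ 3 r ψ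

/-- **P60 (g)(i), per state, on the `4 × 4` torus.** For EVERY state `ψ` of the `4 × 4` fermionic torus
(any filling, any `S^z`, no symmetry assumed) the sixteen translation-averaged `d`-wave rows satisfy
`Σ_{a,b=0}^{3} (−1)^{a+b} P̄_d(4, (a,b); ψ) = 0`. For a functional invariant under the point group `D₄`
(rows then depend only on the class of `(a,b)`: `V00; V10 = V01 = V30 = V03; V11 = V13 = V31 = V33;
V20 = V02; V21 = V12 = V23 = V32; V22`) this reads `V00 − 4·V10 + 4·V11 + 2·V20 − 4·V21 + V22 = 0`.
A `pair_dd` profile violating it beyond solver tolerance is a kernel / multiplicity / reduction BUG SIGNAL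
(LEAD LINE (KK) 2026-08-21). [cite: Scalapino1995, §2 eq. (2.4)] [cite: QinEtAl2020, §II eq. (2)–(4)] [folklore] -/
theorem avgPairCorr_four_staggered_sum_eq_zero (ψ : Fock (Orb (FermionTorus 2 4))) :
    avgPairCorr 4 ![0, 0] ψ - avgPairCorr 4 ![0, 1] ψ + avgPairCorr 4 ![0, 2] ψ - avgPairCorr 4 ![0, 3] ψ
      - avgPairCorr 4 ![1, 0] ψ + avgPairCorr 4 ![1, 1] ψ - avgPairCorr 4 ![1, 2] ψ + avgPairCorr 4 ![1, 3] ψ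
      + avgPairCorr 4 ![2, 0] ψ - avgPairCorr 4 ![2, 1] ψ + avgPairCorr 4 ![2, 2] ψ - avgPairCorr 4 ![2, 3] ψ
      - avgPairCorr 4 ![3, 0] ψ + avgPairCorr 4 ![3, 1] ψ - avgPairCorr 4 ![3, 2] ψ + avgPairCorr 4 ![3, 3] ψ
      = 0 := by
  have h := sum_stagger_re_mul_pairCorrSum_re_eq_zero two_dvd_four dWaveFormFactor
    dWaveFormFactor_zero (fun _ => dWaveFormFactor_neg _) ψ
  rw [sum_univ_torusSite_four] at h
  have p00 : torusSiteParity two_dvd_four (Torus.proj 4 ![0, 0]) = 0 := by decide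
  have p01 : torusSiteParity two_dvd_four (Torus.proj 4 ![0, 1]) ≠ 0 := by decide
  have p02 : torusSiteParity two_dvd_four (Torus.proj 4 ![0, 2]) = 0 := by decide
  have p03 : torusSiteParity two_dvd_four (Torus.proj 4 ![0, 3]) ≠ 0 := by decide
  have p10 : torusSiteParity two_dvd_four (Torus.proj 4 ![1, 0]) ≠ 0 := by decide
  have p11 : torusSiteParity two_dvd_four (Torus.proj 4 ![1, 1]) = 0 := by decide
  have p12 : torusSiteParity two_dvd_four (Torus.proj 4 ![1, 2]) ≠ 0 := by decide
  have p13 : torusSiteParity two_dvd_four (Torus.proj 4 ![1, 3]) = 0 := by decide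
  have p20 : torusSiteParity two_dvd_four (Torus.proj 4 ![2, 0]) = 0 := by decide
  have p21 : torusSiteParity two_dvd_four (Torus.proj 4 ![2, 1]) ≠ 0 := by decide
  have p22 : torusSiteParity two_dvd_four (Torus.proj 4 ![2, 2]) = 0 := by decide
  have p23 : torusSiteParity two_dvd_four (Torus.proj 4 ![2, 3]) ≠ 0 := by decide
  have p30 : torusSiteParity two_dvd_four (Torus.proj 4 ![3, 0]) ≠ 0 := by decide
  have p31 : torusSiteParity two_dvd_four (Torus.proj 4 ![3, 1]) = 0 := by decide
  have p32 : torusSiteParity two_dvd_four (Torus.proj 4 ![3, 2]) ≠ 0 := by decide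
  have p33 : torusSiteParity two_dvd_four (Torus.proj 4 ![3, 3]) = 0 := by decide
  rw [stagger_re_of_parity_eq_zero _ p00, stagger_re_of_parity_ne_zero _ p01,
    stagger_re_of_parity_eq_zero _ p02, stagger_re_of_parity_ne_zero _ p03,
    stagger_re_of_parity_ne_zero _ p10, stagger_re_of_parity_eq_zero _ p11,
    stagger_re_of_parity_ne_zero _ p12, stagger_re_of_parity_eq_zero _ p13,
    stagger_re_of_parity_eq_zero _ p20, stagger_re_of_parity_ne_zero _ p21,
    stagger_re_of_parity_eq_zero _ p22, stagger_re_of_parity_ne_zero _ p23,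
    stagger_re_of_parity_ne_zero _ p30, stagger_re_of_parity_eq_zero _ p31,
    stagger_re_of_parity_ne_zero _ p32, stagger_re_of_parity_eq_zero _ p33] at h
  simp only [avgPairCorr_four]
  linear_combination h / 16

end Four

end Summit.HubbardSuperconductivity.HubbardLadder

end
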